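import Summits.BirchSwinnertonDyer.BirchSwinnertonDyer.Theorems.PrintCf2RamifiedOffTYZMoverSumBlocks
import Literature.NumberTheory.EllipticCurves.Smith2016.CongruentNumberGenusDeterminantRowsTwoThreeUnconditional
import HarnessLib

/-!
# Crux `PrintCf2.RamifiedOffTYZOfFacts` (stmt-BirchSwinnertonDyer-20509), line `offtyz-v7`, LEAD cycle 8 (cruxlead-20509 g7):
# THE BLOCK-SUM CRITERION FOR ALL ODD `n ≡ 5, 7 (mod 8)` — infrastructure for the `n ≡ 7 (mod 8)` sector

THEOREMS ONLY (no `def`, no `sorry`), `--supports stmt-BirchSwinnertonDyer-20509`.  `…MoverSumBlocks` proved, for `n ≡ 5 (mod 8)`,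
`g*g moves P(n) ⟺ Σ_{S adm} w_S·(1 + x₋ + Σ_{i∈S} xᵢ)·(ρ(N_S)·x) = 1`.  Everything in that proof is odd-`n` bookkeeping except the cofactor parity
`|𝓛(n/d_S)| ≡ coblockWeight p S`, which used Smith's row 1 (`n/d_S ≡ 1 (mod 8)`).  For `n ≡ 7 (mod 8)` the admissible blocks `d_S ≡ 5 (mod 8)` have
cofactors `≡ 3 (mod 8)`, where Smith's row 3 (`Smith2016.card_selmerGroup_two_eq_four_iff_odd_genusSum₁_three`, tree theorem) gives the same
parity, and the full block `S = univ` is never admissible (its term `ι(n)` vanishes).  This file proves the criterion for `n ≡ 5 ∨ n ≡ 7 (mod 8)`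
(`sqMover_iff_sum_blocks_odd`).  What the `n ≡ 7` sector still lacks is the evaluation of the block sum, i.e. g5's (★) for `∏ pᵢ ≡ 7 (mod 8)`
(g6's `qFormIdentityOmega` is proved for `≡ 5` only); granted it, the two test vectors of `…SelmerRankOneMover` give «mover ⟺ q(κ) ≠ 0» there.
BSD is not proved by any of this; no class is closed by this file.

References: [cite: TianYuanZhang2017, Thm. 1.1, §3.1 (p0011 L53–L73), Prop. 3.2 (1), Thm. 3.6 (1), proof of Lemma 3.21 (p0020 L27–L63)];
[cite: Smith2016CongruentDensity, Thm. 1.2 and Thm. 2.2 rows 1, 3]; [cite: HeathBrown1994SelmerCongruentII, Appendix (Monsky), typescript p. 39 L13–L41].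
-/

noncomputable section

open scoped Classical NumberField

open WeierstrassCurve WeierstrassCurve.Affine Finset Matrix Literature.NumberTheory.EllipticCurves
  Literature.NumberTheory.EllipticCurves.TianYuanZhang2017
  Literature.NumberTheory.EllipticCurves.TianYuanZhang2017.W2
  Literature.NumberTheory.EllipticCurves.HeathBrown1994
  Literature.NumberTheory.EllipticCurves.Smith2016
  Literature.NumberTheory.EllipticCurves.MonskySelmerParity
  Literature.NumberTheory.QuadraticFields.RingClass
  Literature.NumberTheory.QuadraticFields
  Summit.BirchSwinnertonDyer.Rank1Residual.P2.GenusPeriodTransferLayer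
  Summit.BirchSwinnertonDyer.Rank1Residual.P2.ThetaDescent
  Summit.BirchSwinnertonDyer.PrintCf2.QForm

set_option autoImplicit false

namespace Summit.BirchSwinnertonDyer.PrintCf2.MoverAssembly

variable {k : ℕ} (p : Fin k → ℕ) (hp : ∀ i, (p i).Prime) (hodd : ∀ i, Odd (p i)) (hinj : Function.Injective p)

/-! ## §1 Cofactor parity for cofactors `≡ 1` or `≡ 3 (mod 8)` -/

variable {n : ℕ} (D : GenusPointData n)

include hp hodd hinj in
/-- **`|𝓛(n/d_S)| ≡ det M_{n/d_S} = coblockWeight p S (mod 2)`** for `n = p₁⋯p_k ≡ 5` or `7 (mod 8)` and an admissible `S ≠ univ` (cofactor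
`≡ 1` resp. `≡ 3 (mod 8)`), RELATIVE to TYZ Thm 1.1; via Smith 2016 Thm 1.2 rows 1 / 3 and Monsky's exact formula (tree theorems).
[cite: TianYuanZhang2017, Thm. 1.1 (p0002 L90–L99)] [cite: Smith2016CongruentDensity, Thm. 1.2 and Thm. 2.2 rows 1, 3] [cite: HeathBrown1994SelmerCongruentII, Appendix (Monsky), typescript p. 39 L27–L33] -/
theorem scriptL_parity_eq_coblockWeight_odd (h11 : thm11_parity_of_scriptL) (hn : n = ∏ i, p i) (h57 : n % 8 = 5 ∨ n % 8 = 7)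
    (hLs : D.scriptLSpec) (S : Finset (Fin k)) (hS : (∏ i ∈ S, p i) % 8 = 5) (hSu : S ≠ univ) :
    (((D.scriptL (n / ∏ i ∈ S, p i)).natAbs : ℕ) : ZMod 2) = coblockWeight p S := by
  rcases h57 with h5 | h7
  · exact scriptL_parity_eq_coblockWeight p hp hodd hinj D h11 hn h5 hLs S hS hSu
  have hp2 : ∀ i, p i ≠ 2 := ne_two_of_odd p hodd
  set m := n / ∏ i ∈ S, p i with hm
  have hmprod : m = ∏ i ∈ Sᶜ, p i := by rw [hm, hn]; exact prod_div_blockProd p hp S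
  set q : Fin Sᶜ.card → ℕ := blockPrimes p Sᶜ with hq
  have hqprod : ∏ t, q t = m := by rw [hmprod]; exact prod_blockPrimes p Sᶜ
  have hqp : ∀ t, (q t).Prime := blockPrimes_prime p hp Sᶜ
  have hqodd : ∀ t, Odd (q t) := blockPrimes_odd p hodd Sᶜ
  have hqinj : Function.Injective q := blockPrimes_injective p hinj Sᶜ
  have hn0 : n ≠ 0 := by rw [hn]; exact Finset.prod_ne_zero_iff.mpr fun i _ => (hp i).ne_zero
  have hdvd : m ∣ n := by rw [hmprod, hn]; exact Finset.prod_dvd_prod_of_subset _ _ _ (subset_univ _)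
  have hmdiv : m ∈ n.divisors := Nat.mem_divisors.mpr ⟨hdvd, hn0⟩
  have hne : Sᶜ.Nonempty := by
    rw [Finset.nonempty_iff_ne_empty, Ne, Finset.compl_eq_empty_iff]; exact hSu
  have hm1 : 1 < m := by
    obtain ⟨i, hi⟩ := hne
    rw [hmprod, ← Finset.mul_prod_erase _ _ hi]
    have h1 := (hp i).one_lt
    have h2 := blockProd_pos p hp (Sᶜ.erase i)
    nlinarith
  -- cofactor `≡ 3 (mod 8)`: `5·m ≡ 7 (mod 8)` forces `m ≡ 3`
  have hm8 : m % 8 = 3 := by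
    have hdm : (∏ i ∈ S, p i) * m = n := by
      rw [hm]; exact Nat.mul_div_cancel' (by rw [hn]; exact Finset.prod_dvd_prod_of_subset _ _ _ (subset_univ S))
    have h1 : (5 * ∏ i ∈ S, p i) % 8 = 1 := by omega
    have h2 : (5 * n) % 8 = 3 := by omega
    have e : 5 * n = (5 * ∏ i ∈ S, p i) * m := by rw [mul_assoc, hdm]
    have := Nat.mul_mod (5 * ∏ i ∈ S, p i) m 8
    rw [← e, h2, h1, one_mul, Nat.mod_mod] at this
    exact this.symm
  have hmsq : Squarefree m := by rw [← hqprod]; exact squarefree_prod_of_injective q hqp hqinj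
  obtain ⟨L, hL, hLpar⟩ := h11 m hmsq (Or.inr (Or.inr hm8)) GenusField (isGenusFieldFamily_genusField m)
  have hLD : IsScriptL m (D.scriptL m) := hLs m hmdiv hm1
  have hpar : (((D.scriptL m).natAbs : ℕ) : ZMod 2) = (L : ZMod 2) := by
    rw [natCast_natAbs_zmod_two]
    rcases LevelTwo.eq_or_eq_neg_of_isScriptL hLD hL with h | h
    · rw [h]
    · rw [h, Int.cast_neg, ZMod.neg_eq_self_mod_two]
  rw [hpar, hLpar]
  have hiff : Odd (genusSum₁ m fun d => genusClassNumber (GenusField d)) ↔ (monskyMatrixOdd q).det = 1 := by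
    rw [← hqprod, ← card_selmerGroup_two_eq_four_iff_odd_genusSum₁_three q hqp hqodd hqinj (by rw [hqprod]; exact hm8),
      card_selmerGroup_two_eq_four_iff_det_monskyMatrixOdd q hqp hqodd hqinj]
  have hcw : coblockWeight p S = (monskyMatrixOdd q).det := rfl
  rw [hcw]
  have hval : ∀ x : ZMod 2, x = 0 ∨ x = 1 := by decide
  rcases hval (monskyMatrixOdd q).det with h0 | h1
  · rw [h0]
    have hno : ¬ Odd (genusSum₁ m fun d => genusClassNumber (GenusField d)) := fun ho => by
      rw [hiff, h0] at ho; exact zero_ne_one ho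
    rw [odd_iff_natCast_zmod_two_eq_one] at hno
    rcases hval ((genusSum₁ m fun d => genusClassNumber (GenusField d) : ℕ) : ZMod 2) with h | h
    · exact h
    · exact absurd h hno
  · rw [h1]
    exact (odd_iff_natCast_zmod_two_eq_one _).mp (hiff.mpr h1)

/-! ## §2 Divisor bookkeeping for odd `n` -/

/-- For `n ≡ 5` or `7 (mod 8)`: a divisor `d ≡ 5 (mod 8)` with `d ≠ n` lies in `recursionIndex n` (cofactor `≡ 1` resp. `≡ 3 (mod 8)`, `> 1`).
[cite: TianYuanZhang2017, §3.1 (p0011 L67–L70)] -/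
theorem mem_recursionIndex_of_mod_eight_odd {n d : ℕ} (h57 : n % 8 = 5 ∨ n % 8 = 7) (hd : d ∈ n.divisors) (hd5 : d % 8 = 5) (hdn : d ≠ n) :
    d ∈ recursionIndex n := by
  rcases h57 with h5 | h7
  · exact mem_recursionIndex_of_mod_eight h5 hd hd5 hdn
  rw [mem_recursionIndex_iff]
  obtain ⟨hdvd, hn0⟩ := Nat.mem_divisors.mp hd
  have hdm : d * (n / d) = n := Nat.mul_div_cancel' hdvd
  have hq0 : n / d ≠ 0 := fun h => hn0 (by rw [← hdm, h, mul_zero])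
  have hq1 : n / d ≠ 1 := fun h => hdn (by rw [← hdm, h, mul_one])
  have hmod : (n / d) % 8 = 3 := by
    have h1 : (5 * d) % 8 = 1 := by omega
    have h2 : (5 * n) % 8 = 3 := by omega
    have e : 5 * n = (5 * d) * (n / d) := by rw [mul_assoc, hdm]
    have := Nat.mul_mod (5 * d) (n / d) 8
    rw [← e, h2, h1, one_mul, Nat.mod_mod] at this
    exact this.symm
  exact ⟨hd, Or.inl hd5, Or.inr (Or.inr hmod), Nat.lt_of_le_of_ne (Nat.one_le_iff_ne_zero.mpr hq0) (Ne.symm hq1)⟩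

/-! ## §3 The criterion for odd `n ≡ 5, 7 (mod 8)` -/

include hp hodd hinj in
/-- **`g*g` MOVES `P(n)` iff the block sum is `1`, for ALL odd `n = p₁⋯p_k ≡ 5, 7 (mod 8)`** (hypotheses as in `sqMover_iff_sum_blocks`):
`g*g·P(n) ≠ P(n) ⟺ Σ_{S : d_S ≡ 5 (8)} coblockWeight p S·(1 + [g moves i] + Σ_{i∈S} xᵢ(g))·(Σ_{i∈S} blockRho p S i·xᵢ(g)) = 1`.
[cite: TianYuanZhang2017, §3.1 (p0011 L53–L73), Thm. 1.1, Prop. 3.2 (1), Thm. 3.6 (1), proof of Lemma 3.21 (p0020 L27–L63)]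
[cite: HeathBrown1994SelmerCongruentII, Appendix (Monsky), typescript p. 39 L13–L41] [cite: Smith2016CongruentDensity, Thm. 1.2 rows 1, 3] -/
theorem sqMover_iff_sum_blocks_odd (hn : n = ∏ i, p i) (h57 : n % 8 = 5 ∨ n % 8 = 7) (hrec : D.recursion) (hLs : D.scriptLSpec)
    (z : ℕ → APoint D.H) (Φ : ℕ → Finset (D.H ≃ₐ[ℚ] D.H)) (ΓH ΓH' : ℕ → Subgroup (D.H ≃ₐ[ℚ] D.H))
    (σ : ℕ → (D.H ≃ₐ[ℚ] D.H)) (c : D.H ≃ₐ[ℚ] D.H) (ρ : (d : ℕ) → (D.galK d →* RingClassGroup (GenusField d) 2))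
    (hc : D.ConjSpec c)
    (hblock : ∀ d ∈ n.divisors, ((d % 8 = 5 ∨ d % 8 = 6) → D.CMBlockSpec d (z d) (Φ d) (ΓH d) (ΓH' d) (σ d) c) ∧
      (d % 8 = 7 → D.SevenBlockSpec d))
    (hring : ∀ d ∈ n.divisors, d % 8 = 5 → D.RingClassTwoBlockSpec d (ΓH d) (ΓH' d) (ρ d))
    (hFrob : ∀ d ∈ n.divisors, d % 8 = 5 → ∀ q : ℕ, q.Prime → q ∣ d → ∃ φ : D.H ≃ₐ[ℚ] D.H,
      φ (D.sqrtNeg d) = D.sqrtNeg d ∧ φ * φ ∈ ΓH' d ∧ φ D.im = (jacobiSym (-1) q) • D.im ∧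
        ∀ r : ℕ, r.Prime → r ∣ n → r ≠ q → φ (D.sqrtNeg r) = (jacobiSym (-(r : ℤ)) q) • D.sqrtNeg r)
    (h11 : thm11_parity_of_scriptL) (g : D.H ≃ₐ[ℚ] D.H) :
    D.galPt (g * g) (D.P n) ≠ D.P n ↔
      (∑ S : Finset (Fin k), (if (∏ i ∈ S, p i) % 8 = 5 then
          coblockWeight p S *
            (1 + ((if g D.im = D.im then (0 : ZMod 2) else 1) +
              ∑ i ∈ S, (if g (D.im * D.sqrtNeg (p i)) = D.im * D.sqrtNeg (p i) then (0 : ZMod 2) else 1))) *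
            ∑ i ∈ S, blockRho p S i * (if g (D.im * D.sqrtNeg (p i)) = D.im * D.sqrtNeg (p i) then (0 : ZMod 2) else 1)
        else 0)) = 1 := by
  have hsq : Squarefree n := by rw [hn]; exact squarefree_prod_of_injective p hp hinj
  have hn0 : n ≠ 0 := hsq.ne_zero
  have hnn : n ∈ n.divisors := Nat.mem_divisors_self n hn0
  set ι : ℕ → ℕ := fun d =>
    if d % 8 = 5 ∧ g (D.sqrtNeg d) = D.sqrtNeg d ∧ (g * g) ^ gK d * (σ d)⁻¹ ∈ ΓH' d then 1 else 0 with hι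
  rw [galPt_mul_self_P_ne_iff D hsq h57 hrec z Φ ΓH ΓH' σ c hc hblock g, odd_iff_natCast_zmod_two_eq_one,
    Nat.cast_add, Nat.cast_sum]
  rw [Finset.sum_congr rfl (fun d _ => Nat.cast_mul ((D.scriptL (n / d)).natAbs) (ι d))]
  set F : ℕ → ZMod 2 := fun d => (if d = n then 1 else (((D.scriptL (n / d)).natAbs : ℕ) : ZMod 2)) * (ι d : ZMod 2) with hF
  have hsum : ((ι n : ℕ) : ZMod 2) + ∑ d ∈ recursionIndex n, (((D.scriptL (n / d)).natAbs : ℕ) : ZMod 2) * ((ι d : ℕ) : ZMod 2) =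
      ∑ d ∈ n.divisors, F d := by
    rw [← Finset.add_sum_erase _ _ hnn]
    congr 1
    · simp only [hF, if_true, one_mul]
    · have hsub : recursionIndex n ⊆ n.divisors.erase n := by
        intro d hd
        rw [mem_recursionIndex_iff] at hd
        refine mem_erase.mpr ⟨?_, hd.1⟩
        rintro rfl
        have : d / d = 1 := Nat.div_self (Nat.pos_of_mem_divisors hd.1)
        omega
      rw [← Finset.sum_subset hsub]
      · refine Finset.sum_congr rfl fun d hd => ?_
        have hdn : d ≠ n := by
          rintro rfl
          rw [mem_recursionIndex_iff] at hd
          have : d / d = 1 := Nat.div_self (Nat.pos_of_mem_divisors hd.1)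
          omega
        simp only [hF, if_neg hdn]
      · intro d hd hdn
        obtain ⟨hne, hdd⟩ := mem_erase.mp hd
        have h5d : ¬ d % 8 = 5 := fun h5d => hdn (mem_recursionIndex_of_mod_eight_odd h57 hdd h5d hne)
        have hι0 : ι d = 0 := by
          simp only [hι]
          rw [if_neg]
          exact fun h => h5d h.1
        simp only [hF, hι0, Nat.cast_zero, mul_zero]
  have hdiv : n.divisors = (∏ i, p i).divisors := by rw [hn]
  rw [hsum, hdiv, ← sum_powerset_eq_sum_divisors p hp hinj F]
  have hterm : ∀ S : Finset (Fin k), F (∏ i ∈ S, p i) = (if (∏ i ∈ S, p i) % 8 = 5 then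
      coblockWeight p S *
        (1 + ((if g D.im = D.im then (0 : ZMod 2) else 1) +
          ∑ i ∈ S, (if g (D.im * D.sqrtNeg (p i)) = D.im * D.sqrtNeg (p i) then (0 : ZMod 2) else 1))) *
        ∑ i ∈ S, blockRho p S i * (if g (D.im * D.sqrtNeg (p i)) = D.im * D.sqrtNeg (p i) then (0 : ZMod 2) else 1)
      else 0) := by
    intro S
    by_cases hS : (∏ i ∈ S, p i) % 8 = 5
    · rw [if_pos hS]
      have hdS : (∏ i ∈ S, p i) ∈ n.divisors := by rw [hn]; exact blockProd_mem_divisors p hp S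
      have hw : (if (∏ i ∈ S, p i) = n then (1 : ZMod 2) else (((D.scriptL (n / ∏ i ∈ S, p i)).natAbs : ℕ) : ZMod 2)) =
          coblockWeight p S := by
        by_cases hSu : S = univ
        · subst hSu
          rw [if_pos (by rw [hn]), coblockWeight_univ]
        · rw [if_neg (fun h => hSu (eq_univ_of_blockProd_eq p hp hinj S (by rw [h, hn]))),
            scriptL_parity_eq_coblockWeight_odd p hp hodd hinj D h11 hn h57 hLs S hS hSu]
      have hblk := sqMotion_eq_sum_blockRho_mul_bits p hp hodd hinj D hn S hS ((hblock _ hdS).1 (Or.inl hS)) (hring _ hdS hS)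
        (hFrob _ hdS hS) g
      have hrel := bit_sqrtNeg_eq_bit_im_add_sum D (blockPrimes p S) hdS (prod_blockPrimes p S) g
      have hreidx : (∑ t, (if g (D.im * D.sqrtNeg (blockPrimes p S t)) = D.im * D.sqrtNeg (blockPrimes p S t) then (0 : ZMod 2) else 1)) =
          ∑ i ∈ S, (if g (D.im * D.sqrtNeg (p i)) = D.im * D.sqrtNeg (p i) then (0 : ZMod 2) else 1) := by
        simp only [blockPrimes_apply]
        rw [← sum_coe_sort S]
        exact (S.orderIsoOfFin rfl).toEquiv.sum_comp
          (fun x : {x // x ∈ S} => if g (D.im * D.sqrtNeg (p (x : Fin k))) = D.im * D.sqrtNeg (p (x : Fin k)) then (0 : ZMod 2) else 1)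
      rw [hreidx] at hrel
      simp only [hF, hι]
      rw [hw]
      by_cases hfix : g (D.sqrtNeg (∏ i ∈ S, p i)) = D.sqrtNeg (∏ i ∈ S, p i)
      · rw [if_pos hfix] at hrel
        rw [← hrel, add_zero, mul_one, ← hblk hfix]
        by_cases hmem : (g * g) ^ gK (∏ i ∈ S, p i) * (σ (∏ i ∈ S, p i))⁻¹ ∈ ΓH' (∏ i ∈ S, p i)
        · rw [if_pos ⟨hS, hfix, hmem⟩, if_pos hmem, Nat.cast_one]
        · rw [if_neg (fun h => hmem h.2.2), if_neg hmem, Nat.cast_zero]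
      · rw [if_neg hfix] at hrel
        rw [← hrel, if_neg (fun h => hfix h.2.1), Nat.cast_zero, mul_zero, CharTwo.add_self_eq_zero, mul_zero, zero_mul]
    · rw [if_neg hS]
      have hι0 : ι (∏ i ∈ S, p i) = 0 := by
        simp only [hι]
        rw [if_neg]
        exact fun h => hS h.1
      simp only [hF, hι0, Nat.cast_zero, mul_zero]
  rw [Finset.sum_congr rfl (fun S _ => hterm S)]

end Summit.BirchSwinnertonDyer.PrintCf2.MoverAssembly

end
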